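import Literature.AlgebraicGeometry.Resolution.PIndependence
import Literature.AlgebraicGeometry.Resolution.FormalFibresProofs
import Literature.FieldTheory.Separability.PIndependentDerivations

/-!
# `PAlteration.PicoverToRadicialBottom`: a `p`-basis adapted to finitely many constants

Route `ResolutionOfSingularities/pAlteration`, crux `PicoverToRadicialBottom`
(stmt-ResolutionOfSingularities-0556), line `theta-finite-cofinite-roots`. Helper file
(`--supports`) proving the registered stub `stub_pBasisDerivations` (T3): for a finite set `C` of
a field `k` of characteristic `p` and `r : ℕ` there are `u_i ∈ k` and derivations `D_i ∈ Der(k)`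
with `D_i(u_j) = δ_ij`, `D_i(c) = 0` for `c ∈ C`, and `k` module-finite over the subring
`k^{p^r}[u_i : i]` (which is the field `k^{p^r}(u_i : i)`).

Proof (Matsumura, *Commutative Ring Theory*, §26 p. 202): take a `p`-basis `Γ` of `k` over `k^p`
(`exists_isPIndependent_adjoin_eq_top`), a finite `B₀ ⊆ Γ` with `C ⊆ k^p(B₀)`
(`IntermediateField.exists_finset_of_mem_adjoin`), and `u` the inclusion of `Γ ∖ B₀`. Each
`γ ∈ Γ` lies outside `k^p(Γ ∖ {γ})` (`adjoin_inf_adjoin_eq_bot_of_isPIndependent`), whence a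
derivation `D_γ` with `D_γ(γ) = 1` vanishing on `k^p(Γ ∖ {γ}) ⊇ C ∪ (Γ ∖ {γ})`
(`exists_derivation_eq_one_eqOn_zero`). Finiteness: `k = k^{p^j}(Γ)` for every `j` (induction),
so `k = M(B₀)` is finite over `M = k^{p^r}(Γ ∖ B₀)`, and `M` is the subring generated by
`k^{p^r}` and `Γ ∖ B₀` because everything is algebraic over `k^{p^r}`.
-/

noncomputable section

-- single-problem summit: the doubled namespace component `ResolutionOfSingularities` is forced
set_option linter.dupNamespace false

open IntermediateField Module
open Literature.AlgebraicGeometry.Resolution Literature.FieldTheory.Separability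

namespace Summit.ResolutionOfSingularities.ResolutionOfSingularities.Theorems

section Helpers

variable {k : Type} [Field k] (p : ℕ) [Fact p.Prime] [CharP k p]

/-- An element of a `p`-independent set `Γ` (over `k^p`) does not lie in the cofinite subfield
`k^p(Γ ∖ {γ})`: otherwise `γ ∈ k^p(γ) ∩ k^p(t) = k^p` for a finite `t ⊆ Γ ∖ {γ}`, so
`[k^p(γ) : k^p] = 1 ≠ p`. [cite: Matsumura1987, §26 p. 202] -/
theorem not_mem_cofiniteSubfield_of_isPIndependent {Γ : Set k}
    (hΓ : IsPIndependent (F := frobeniusRange k p) p Γ) {γ : k} (hγ : γ ∈ Γ) :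
    γ ∉ cofiniteSubfield p Γ {γ} := by
  classical
  intro hmem
  rw [mem_cofiniteSubfield_iff, Finset.coe_singleton] at hmem
  obtain ⟨t, htΓ, hγt⟩ := exists_finset_of_mem_adjoin hmem
  have htΓ' : (t : Set k) ⊆ Γ := fun x hx => (htΓ hx).1
  have hsΓ : (({γ} : Finset k) : Set k) ⊆ Γ := by
    rw [Finset.coe_singleton, Set.singleton_subset_iff]
    exact hγ
  have hγs : γ ∈ adjoin (frobeniusRange k p) (({γ} : Finset k) : Set k) := by
    rw [Finset.coe_singleton]
    exact mem_adjoin_simple_self _ γ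
  have hdisj : Disjoint ({γ} : Finset k) t := by
    rw [Finset.disjoint_singleton_left]
    intro h
    exact (htΓ (Finset.mem_coe.mpr h)).2 rfl
  have hbot : γ ∈ (⊥ : IntermediateField (frobeniusRange k p) k) := by
    rw [← adjoin_inf_adjoin_eq_bot_of_isPIndependent hΓ {γ} t hsΓ htΓ' hdisj]
    exact ⟨hγs, hγt⟩
  have h1 : finrank (frobeniusRange k p)
      (adjoin (frobeniusRange k p) (({γ} : Finset k) : Set k)) = 1 := by
    rw [Finset.coe_singleton, finrank_adjoin_simple_eq_one_iff]
    exact hbot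
  have hp := hΓ.finrank_eq {γ} hsΓ
  rw [h1, Finset.card_singleton, pow_one] at hp
  exact (Fact.out : p.Prime).one_lt.ne hp

omit [Fact p.Prime] [CharP k p] in
/-- If `k = k^p(Γ)` then `k = k^{p^j}(Γ)` for every `j` (induction on `j`: the subfield
`k^{p^{j+1}}(Γ)` contains the `p`-th powers of `k^{p^j}(Γ) = k`, hence `k^p ∪ Γ`). [folklore] -/
theorem mem_closure_range_iterateFrobenius [ExpChar k p] {Γ : Set k}
    (hΓ : ∀ x : k, x ∈ Subfield.closure (Set.range (frobenius k p) ∪ Γ)) (j : ℕ) (x : k) :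
    x ∈ Subfield.closure (Set.range (iterateFrobenius k p j) ∪ Γ) := by
  induction j generalizing x with
  | zero => exact Subfield.subset_closure (Or.inl ⟨x, iterateFrobenius_zero_apply k p x⟩)
  | succ j ih =>
    set N := Subfield.closure (Set.range (iterateFrobenius k p (j + 1)) ∪ Γ)
    have hΓN : Γ ⊆ N := fun γ hγ => Subfield.subset_closure (Or.inr hγ)
    have hle : Subfield.closure (Set.range (iterateFrobenius k p j) ∪ Γ) ≤
        N.comap (frobenius k p) := by
      rw [Subfield.closure_le]
      rintro y (⟨z, rfl⟩ | hy)
      · rw [SetLike.mem_coe, Subfield.mem_comap]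
        refine Subfield.subset_closure (Or.inl ⟨z, ?_⟩)
        simp only [iterateFrobenius_def, frobenius_def, ← pow_mul, ← pow_succ]
      · rw [SetLike.mem_coe, Subfield.mem_comap, frobenius_def]
        exact N.pow_mem (hΓN hy) p
    refine (Subfield.closure_le.mpr ?_) (hΓ x)
    rintro y (⟨z, rfl⟩ | hy)
    · exact Subfield.mem_comap.mp (hle (ih z))
    · exact hΓN hy

/-- **`k` is module-finite over the subring `k^{p^r}[Γ ∖ B₀]`** when `k^p(Γ) = k` and `B₀` is
finite: `k = M(B₀)` with `M = k^{p^r}(Γ ∖ B₀)` and `b^{p^r} ∈ M`, and `M` is already the subring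
generated by `k^{p^r} ∪ (Γ ∖ B₀)` (all generators are algebraic over the field `k^{p^r}`).
[cite: Matsumura1987, §26 p. 202] -/
theorem module_finite_closure_of_adjoin_eq_top {Γ : Set k}
    (hΓtop : adjoin (frobeniusRange k p) Γ = ⊤) (B₀ : Finset k) (r : ℕ) :
    Module.Finite
      (Subring.closure (Set.range (iterateFrobenius k p r) ∪ (Γ \ (B₀ : Set k)))) k := by
  have hp : p.Prime := Fact.out
  set K₀ : Subfield k := (iterateFrobenius k p r).fieldRange with hK₀
  set T : Set k := Γ \ (B₀ : Set k) with hT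
  -- every element of `k` is integral over `K₀ = k^{p^r}`
  have hint : ∀ x : k, IsIntegral K₀ x := fun x => by
    refine IsIntegral.of_pow (pow_pos hp.pos r) ?_
    exact isIntegral_algebraMap (R := K₀) (A := k)
      (x := ⟨x ^ p ^ r, RingHom.mem_fieldRange.mpr ⟨x, iterateFrobenius_def ..⟩⟩)
  have h1 : Set.range (algebraMap K₀ k) = Set.range (iterateFrobenius k p r) := by
    ext y
    constructor
    · rintro ⟨z, rfl⟩
      obtain ⟨w, hw⟩ := RingHom.mem_fieldRange.mp z.2
      exact ⟨w, hw⟩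
    · rintro ⟨w, rfl⟩
      exact ⟨⟨_, RingHom.mem_fieldRange.mpr ⟨w, rfl⟩⟩, rfl⟩
  have h2 : Set.range (algebraMap (frobeniusRange k p) k) = Set.range (frobenius k p) := by
    ext y
    constructor
    · rintro ⟨z, rfl⟩
      obtain ⟨w, hw⟩ := (mem_frobeniusRange_iff p).mp z.2
      exact ⟨w, (frobenius_def ..).trans hw⟩
    · rintro ⟨w, rfl⟩
      exact ⟨⟨_, (mem_frobeniusRange_iff p).mpr ⟨w, (frobenius_def ..).symm⟩⟩, rfl⟩
  -- `k = K₀(Γ)`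
  have hall : ∀ x : k, x ∈ adjoin K₀ Γ := by
    intro x
    rw [← mem_toSubfield, adjoin_toSubfield, h1]
    refine mem_closure_range_iterateFrobenius p (fun y => ?_) r x
    have hy : y ∈ adjoin (frobeniusRange k p) Γ := by rw [hΓtop]; exact mem_top
    rwa [← mem_toSubfield, adjoin_toSubfield, h2] at hy
  -- `k = M(B₀)` is finite over `M = K₀(Γ ∖ B₀)`
  set M : IntermediateField K₀ k := adjoin K₀ T with hM
  have hfin : FiniteDimensional M (adjoin M (B₀ : Set k)) :=
    finiteDimensional_adjoin fun x _ => (hint x).tower_top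
  have htop : adjoin M (B₀ : Set k) = ⊤ := by
    apply IntermediateField.restrictScalars_injective K₀
    rw [adjoin_adjoin_left, restrictScalars_top, eq_top_iff]
    intro x _
    refine adjoin.mono _ _ _ (fun y hy => ?_) (hall x)
    by_cases hyB : y ∈ (B₀ : Set k)
    · exact Or.inr hyB
    · exact Or.inl ⟨hy, hyB⟩
  rw [htop] at hfin
  haveI : FiniteDimensional M k :=
    LinearEquiv.finiteDimensional (IntermediateField.topEquiv (F := M) (E := k)).toLinearEquiv
  -- `M` is contained in the subring generated by `k^{p^r}` and `Γ ∖ B₀`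
  have hMS : ∀ x : k, x ∈ M →
      x ∈ Subring.closure (Set.range (iterateFrobenius k p r) ∪ T) := by
    intro x hx
    have hx' : x ∈ M.toSubalgebra := hx
    rwa [hM, adjoin_toSubalgebra_of_isAlgebraic (fun y _ => (hint y).isAlgebraic),
      Algebra.mem_adjoin_iff, h1] at hx'
  letI : SMul M (Subring.closure (Set.range (iterateFrobenius k p r) ∪ T)) :=
    ⟨fun a s => ⟨(a : k) * (s : k), Subring.mul_mem _ (hMS _ a.2) s.2⟩⟩
  haveI : IsScalarTower M (Subring.closure (Set.range (iterateFrobenius k p r) ∪ T)) k :=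
    ⟨fun a s x => mul_assoc (a : k) (s : k) x⟩
  exact Module.Finite.of_restrictScalars_finite M _ k

end Helpers

/-- (T3) **A `p`-basis adapted to finitely many constants, with its dual derivations.** For a
finite set `C` of a field `k` of characteristic `p` there are elements `u_i ∈ k` and derivations
`D_i` of `k` with `D_i(u_j) = δ_ij`, `D_i(c) = 0` for `c ∈ C`, and `k` finite over
`k^{p^r}(u_i : i)` (take a `p`-basis `Γ`, a finite `B₀ ⊆ Γ` with `C ⊆ k^p(B₀)`, `u = Γ ∖ B₀`;
Matsumura §26, tree `PIndependence` / `PIndependentDerivations`). [cite: Matsumura1987, §26 p. 202] -/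
theorem stub_pBasisDerivations :
    ∀ (p : ℕ) [Fact p.Prime] (k : Type) [Field k] [CharP k p] (C : Finset k) (r : ℕ),
      ∃ (G : Type) (u : G → k) (D : G → Derivation ℤ k k),
        (∀ i, D i (u i) = 1) ∧ (∀ i j, i ≠ j → D i (u j) = 0) ∧ (∀ i, ∀ c ∈ C, D i c = 0) ∧
        Module.Finite (Subring.closure (Set.range (iterateFrobenius k p r) ∪ Set.range u)) k := by
  intro p _ k _ _ C r
  classical
  -- a `p`-basis `Γ` of `k / k^p`
  obtain ⟨Γ, hΓ, hΓtop⟩ := exists_isPIndependent_adjoin_eq_top (frobeniusRange k p) p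
    (pow_mem_range_algebraMap_frobeniusRange p)
  -- finite supports of the constants
  have hC : ∀ c : k, ∃ α : Finset k, (α : Set k) ⊆ Γ ∧
      c ∈ adjoin (frobeniusRange k p) (α : Set k) :=
    fun c => exists_finset_of_mem_adjoin (by rw [hΓtop]; exact mem_top)
  choose α hαΓ hcα using hC
  set B₀ : Finset k := C.biUnion α with hB₀
  refine ⟨↥(Γ \ (B₀ : Set k)), Subtype.val, ?_⟩
  -- the dual derivations
  have hD : ∀ γ : ↥(Γ \ (B₀ : Set k)), ∃ D : Derivation ℤ k k,
      D γ = 1 ∧ ∀ x ∈ cofiniteSubfield p Γ {(γ : k)}, D x = 0 :=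
    fun γ => exists_derivation_eq_one_eqOn_zero p (cofiniteSubfield p Γ {(γ : k)})
      (pow_mem_cofiniteSubfield p Γ _) (not_mem_cofiniteSubfield_of_isPIndependent p hΓ γ.2.1)
  choose D hD1 hD0 using hD
  refine ⟨D, hD1, fun i j hij => ?_, fun i c hc => ?_, ?_⟩
  · refine hD0 i _ ?_
    rw [mem_cofiniteSubfield_iff]
    refine subset_adjoin _ _ ⟨j.2.1, ?_⟩
    rw [Finset.coe_singleton, Set.mem_singleton_iff]
    exact fun h => hij (Subtype.ext h.symm)
  · refine hD0 i _ ?_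
    rw [mem_cofiniteSubfield_iff]
    have hsub : ((α c : Finset k) : Set k) ⊆ Γ \ ((({(i : k)} : Finset k) : Set k)) := by
      intro x hx
      refine ⟨hαΓ c hx, ?_⟩
      rw [Finset.coe_singleton, Set.mem_singleton_iff]
      rintro rfl
      exact i.2.2 (Finset.mem_coe.mpr (Finset.mem_biUnion.mpr ⟨c, hc, hx⟩))
    exact adjoin.mono _ _ _ hsub (hcα c)
  · rw [Subtype.range_coe]
    exact module_finite_closure_of_adjoin_eq_top p hΓtop B₀ r

end Summit.ResolutionOfSingularities.ResolutionOfSingularities.Theorems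

end
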